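import Literature.Combinatorics.LorentzianPolynomials.LorentzianMeasures
import Literature.Combinatorics.LorentzianPolynomials.Bivariate
import Literature.Combinatorics.LorentzianPolynomials.NonnegativeLinearSubstitution
import HarnessLib

/-!
# Brändén–Huh Proposition 4.22: Lorentzian measures are ultra log-concave, under every external field

Layer `Literature/Combinatorics/LorentzianPolynomials`, namespace `Literature.Combinatorics.LorentzianPolynomials`;
lane `lit-hodgefound` (Track 2 foundations library), seat p16, generation 29 (row g29-#13). Sequel of
`LorentzianMeasures.lean` (row g29-#5: Def. 4.20 `IsLorentzianMeasure`, Props. 4.21, 4.25): the §4.5 property ULC and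
the "external field" construction `P ↦ P̲`, and **Proposition 4.22** — a Lorentzian measure is ULC under every external
field — proved as printed: an external field is a nonnegative diagonal change of variables and the rank sequence is read
off the diagonalization `w_0^n Z_μ(w_1/w_0, …, w_1/w_0)`, both Lorentzian by Theorem 2.10 (tree
`linearSubst_mem_lorentzian`), and a bivariate Lorentzian form has ultra log-concave coefficients by Example 2.26 (tree
`bivariate_mem_lorentzian_iff`).

## Source (verbatim) — P. Brändén, J. Huh, *Lorentzian polynomials* [BrandenHuh2019] (held `paper:arxiv-1902.03719`)

§4.5 (pp. 58–59): "The *partition function* of `μ` is the polynomial `Z_μ(w) = Σ_{S ⊆ [n]} μ({S}) Π_{i ∈ S} w_i`. […]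
The measure `μ` is *ultra log-concave* (ULC) if for every positive integer `k < n`,
`μ(C(n,k))² / C(n,k)² ≥ (μ(C(n,k-1)) / C(n,k-1)) (μ(C(n,k+1)) / C(n,k+1))`. […] Let `P` be a property of discrete
probability measures. We say that `μ` has property `P̲` if, for every `x ∈ ℝ^n_{>0}`, the discrete probability measure
on `{0,1}^n` with the partition function `Z_μ(x_1 w_1, …, x_n w_n) / Z_μ(x_1, …, x_n)` has property `P`. The new
discrete probability measure is said to be obtained from `μ` by applying the *external field* `x ∈ ℝ^n_{>0}`. […]
**Proposition 4.22.** If `μ` is Lorentzian, then `μ` is U̲L̲C̲. *Proof.* Since any probability measure obtained from a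
Lorentzian probability measure by applying an external field is Lorentzian, it suffices to prove that `μ` is ULC. By
Theorem 2.10, the bivariate homogeneous polynomial `w_0^n Z_μ(w_1/w_0, …, w_1/w_0)` is Lorentzian. Therefore, by
Example 2.26, its sequence of coefficients must be ultra log-concave."

## What is here

* §1 `rankSequence μ k = μ(C(n,k)) = Σ_{|S| = k} μ(S)`, `externalField x μ (S) = μ(S) Π_{i∈S} x_i` (the normalisation
  `1/Z_μ(x)` is immaterial for ULC and for Def. 4.20, cf. `IsLorentzianMeasure.smul`), `IsULC μ` (the displayed
  inequalities, = `Bivariate.IsUltraLogConcave n (rankSequence μ)`), and the coefficients of `homPartitionPoly`.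
* §2 The two substitutions of the proof, as instances of Thm. 2.10's `linearSubst`: the external field
  (`linearSubst_diag_homPartitionPoly`) and the diagonalization onto two variables
  (`linearSubst_homPartitionPoly_eq_bivariate`: `w_0^n Z_μ(w_1/w_0,…,w_1/w_0) = Σ_k μ(C(n,k)) w_1^k w_0^{n-k}`).
* §3 **Proposition 4.22**: `isLorentzianMeasure_externalField` ("any probability measure obtained from a Lorentzian
  probability measure by applying an external field is Lorentzian"), `IsLorentzianMeasure.isULC`, and
  `IsLorentzianMeasure.isULC_externalField` (U̲L̲C̲); plus "no internal zeros" of the rank sequence (Example 2.26's second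
  condition).

Definitions with bodies and theorems; no `sorry`, no named fact (net debt 0).

## References

* [BrandenHuh2019] P. Brändén, J. Huh, *Lorentzian polynomials*, Ann. of Math. (2) 192 (2020) 821–891, arXiv:1902.03719 —
  §4.5 (pp. 58–59) Def. 4.20, Prop. 4.22; §2.2 Thm. 2.10; §2.4 Example 2.26.
-/

noncomputable section

open MvPolynomial Finsupp Finset
open scoped Nat

namespace Literature.Combinatorics.LorentzianPolynomials

variable {σ : Type*} [Fintype σ] [DecidableEq σ]

/-! ## §1 Rank sequence, external fields, ULC -/

section Defs

omit [DecidableEq σ] in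
/-- **`μ(C(n,k)) = Σ_{|S| = k} μ(S)`**, the mass of the `k`-subsets: "`μ(C(n,k))`" in the definition of ULC.
[cite: BrandenHuh2019, §4.5 (p. 58, ULC)] -/
def rankSequence (μ : Set σ → ℝ) (k : ℕ) : ℝ := ∑ S ∈ (Finset.univ : Finset (Set σ)).filter (fun S ↦ S.ncard = k), μ S

omit [DecidableEq σ] in
/-- `rankSequence` unfolded. [cite: BrandenHuh2019, §4.5 (p. 58, ULC)] -/
theorem rankSequence_apply (μ : Set σ → ℝ) (k : ℕ) :
    rankSequence μ k = ∑ S ∈ (Finset.univ : Finset (Set σ)).filter (fun S ↦ S.ncard = k), μ S := rfl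

omit [DecidableEq σ] in
/-- `x_i^{[i ∈ S]} = x_i` or `1`. [cite: BrandenHuh2019, §4.5 (p. 59)] -/
theorem pow_indSet_apply (x : σ → ℝ) (S : Set σ) (i : σ) [Decidable (i ∈ S)] :
    x i ^ indSet S i = if i ∈ S then x i else 1 := by
  rw [indSet_apply]
  split_ifs <;> simp

omit [DecidableEq σ] in
/-- **The external field `x`: `S ↦ μ(S) Π_{i ∈ S} x_i`** — the weight whose partition function is `Z_μ(x_1 w_1, …, x_n w_n)`
(Brändén–Huh normalise by `Z_μ(x)`; a positive normalisation is immaterial for Def. 4.20 and for ULC). Written with the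
`0/1` indicator `e_S`: `Π_i x_i^{[i ∈ S]}`. [cite: BrandenHuh2019, §4.5 (p. 59, "applying the external field
`x ∈ ℝ^n_{>0}`")] -/
def externalField (x : σ → ℝ) (μ : Set σ → ℝ) (S : Set σ) : ℝ := μ S * ∏ i, x i ^ indSet S i

omit [DecidableEq σ] in
/-- `externalField x μ S = μ(S) Π_{i ∈ S} x_i`. [cite: BrandenHuh2019, §4.5 (p. 59)] -/
theorem externalField_apply (x : σ → ℝ) (μ : Set σ → ℝ) (S : Set σ) [DecidablePred (· ∈ S)] :
    externalField x μ S = μ S * ∏ i, if i ∈ S then x i else 1 := by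
  rw [externalField]
  congr 1
  exact Finset.prod_congr rfl fun i _ ↦ pow_indSet_apply x S i

omit [DecidableEq σ] in
/-- **ULC**: "for every positive integer `k < n`, `μ(C(n,k))²/C(n,k)² ≥ (μ(C(n,k-1))/C(n,k-1)) (μ(C(n,k+1))/C(n,k+1))`" —
ultra log-concavity (`Bivariate.IsUltraLogConcave`) of the rank sequence. [cite: BrandenHuh2019, §4.5 (p. 58, ULC)] -/
def IsULC (μ : Set σ → ℝ) : Prop := IsUltraLogConcave (Fintype.card σ) (rankSequence μ)

omit [DecidableEq σ] in
/-- `IsULC` unfolded to the displayed inequalities. [cite: BrandenHuh2019, §4.5 (p. 58, ULC)] -/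
theorem isULC_iff (μ : Set σ → ℝ) : IsULC μ ↔ ∀ k, 0 < k → k < Fintype.card σ →
    (rankSequence μ (k - 1) / (Fintype.card σ).choose (k - 1)) *
      (rankSequence μ (k + 1) / (Fintype.card σ).choose (k + 1)) ≤
        (rankSequence μ k / (Fintype.card σ).choose k) ^ 2 :=
  Iff.rfl

omit [DecidableEq σ] in
/-- **The coefficients of the homogenised partition function**: `coeff_{e♮_S} = μ(S)`.
[cite: BrandenHuh2019, §4.5 Def. 4.20 (p. 59)] -/
theorem coeff_homIndSet_homPartitionPoly (μ : Set σ → ℝ) (S : Set σ) :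
    coeff (homIndSet S) (homPartitionPoly μ) = μ S := by
  classical
  rw [homPartitionPoly, coeff_sum, Finset.sum_eq_single_of_mem S (Finset.mem_univ S) fun T _ hT ↦ by
    rw [coeff_monomial, if_neg (fun h ↦ hT (homIndSet_injective h))]]
  rw [coeff_monomial, if_pos rfl]

/-- **A Lorentzian measure is nonnegative.** [cite: BrandenHuh2019, §4.5 Def. 4.20 ("discrete probability measure")] -/
theorem IsLorentzianMeasure.nonneg {μ : Set σ → ℝ} (h : IsLorentzianMeasure μ) (S : Set σ) : 0 ≤ μ S := by
  rw [← coeff_homIndSet_homPartitionPoly μ S]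
  exact coeff_nonneg_of_mem_lorentzian h _

omit [DecidableEq σ] in
/-- `μ ≥ 0 ⟹ μ(C(n,k)) ≥ 0`. [cite: BrandenHuh2019, §4.5 (p. 58)] -/
theorem rankSequence_nonneg {μ : Set σ → ℝ} (hμ : ∀ S, 0 ≤ μ S) (k : ℕ) : 0 ≤ rankSequence μ k :=
  Finset.sum_nonneg fun S _ ↦ hμ S

omit [DecidableEq σ] in
/-- `μ ≥ 0`, `x ≥ 0 ⟹` the external-field weight is `≥ 0`. [cite: BrandenHuh2019, §4.5 (p. 59)] -/
theorem externalField_nonneg {μ : Set σ → ℝ} (hμ : ∀ S, 0 ≤ μ S) {x : σ → ℝ} (hx : ∀ i, 0 ≤ x i) (S : Set σ) :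
    0 ≤ externalField x μ S :=
  mul_nonneg (hμ S) (Finset.prod_nonneg fun i _ ↦ pow_nonneg (hx i) _)

end Defs

/-! ## §2 The two substitutions of the proof -/

section Substitutions

omit [Fintype σ] [DecidableEq σ] in
/-- **A diagonal substitution on a monomial**: `w_o ↦ c_o w_o` sends `r w^d` to `(r Π_o c_o^{d_o}) w^d`.
[cite: BrandenHuh2019, §4.5 proof of Prop. 4.22 (the external field as a change of variables); §2.2 Thm. 2.10] -/
theorem bind₁_smul_X_monomial {τ : Type*} [Fintype τ] (c : τ → ℝ) (d : τ →₀ ℕ) (r : ℝ) :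
    bind₁ (fun o ↦ c o • (X o : MvPolynomial τ ℝ)) (monomial d r) = monomial d (r * ∏ o, c o ^ d o) := by
  have h1 : ∏ i ∈ d.support, (c i • X i : MvPolynomial τ ℝ) ^ d i = ∏ i, (c i • X i : MvPolynomial τ ℝ) ^ d i :=
    Finset.prod_subset (Finset.subset_univ _) fun o _ ho ↦ by rw [Finsupp.notMem_support_iff.1 ho, pow_zero]
  rw [bind₁_monomial, h1, monomial_eq, Finsupp.prod_fintype _ _ (fun o ↦ pow_zero _)]
  simp_rw [smul_eq_C_mul, mul_pow, ← C_pow]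
  rw [Finset.prod_mul_distrib, ← map_prod C, C_mul, mul_assoc]

/-- **The external field is Thm. 2.10's substitution with the diagonal matrix `diag(1, x_1, …, x_n)`**:
`(homPartitionPoly μ)(w_0, x_1 w_1, …, x_n w_n) = homPartitionPoly (externalField x μ)`.
[cite: BrandenHuh2019, §4.5 proof of Prop. 4.22 ("any probability measure obtained from a Lorentzian probability measure
by applying an external field is Lorentzian")] -/
theorem linearSubst_diag_homPartitionPoly (x : σ → ℝ) (μ : Set σ → ℝ) :
    linearSubst (fun o o' : Option σ ↦ if o = o' then o.elim (1 : ℝ) x else 0) (homPartitionPoly μ) =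
      homPartitionPoly (externalField x μ) := by
  classical
  have hg : (fun o : Option σ ↦ ∑ o', (if o = o' then o.elim (1 : ℝ) x else 0) • (X o' : MvPolynomial (Option σ) ℝ)) =
      fun o ↦ o.elim (1 : ℝ) x • X o := by
    funext o
    simp_rw [ite_smul, zero_smul]
    rw [Finset.sum_ite_eq, if_pos (Finset.mem_univ o)]
  rw [linearSubst, hg, homPartitionPoly, homPartitionPoly, map_sum]
  refine Finset.sum_congr rfl fun S _ ↦ ?_
  rw [bind₁_smul_X_monomial, externalField, Fintype.prod_option, Option.elim_none, one_pow, one_mul]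
  simp_rw [Option.elim_some, homIndSet_some]

/-- `r w^{(k,l)} = r w_0^k w_1^l`. [cite: BrandenHuh2019, §2.4 Example 2.26] -/
theorem monomial_bideg (k l : ℕ) (r : ℝ) :
    monomial (bideg k l) r = C r * (X 0 ^ k * X 1 ^ l : MvPolynomial (Fin 2) ℝ) := by
  rw [monomial_eq, bideg_def,
    Finsupp.prod_add_index' (h := fun n e ↦ (X n : MvPolynomial (Fin 2) ℝ) ^ e) (fun _ ↦ pow_zero _)
      (fun _ _ _ ↦ pow_add _ _ _),
    Finsupp.prod_single_index (h := fun n e ↦ (X n : MvPolynomial (Fin 2) ℝ) ^ e) (pow_zero _),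
    Finsupp.prod_single_index (h := fun n e ↦ (X n : MvPolynomial (Fin 2) ℝ) ^ e) (pow_zero _)]

omit [DecidableEq σ] in
/-- **The diagonalization `w_1 = ⋯ = w_n`**: substituting `w_i ↦ v_0` (`i ∈ [n]`) and `w_0 ↦ v_1` in
`w_0^n Z_μ(w_1/w_0, …, w_n/w_0)` gives the bivariate form `Σ_k μ(C(n,k)) v_0^k v_1^{n-k}` — "the bivariate homogeneous
polynomial `w_0^n Z_μ(w_1/w_0, …, w_1/w_0)`", as Thm. 2.10's `linearSubst` with the `0/1` matrix of `some ↦ 0`,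
`none ↦ 1`. [cite: BrandenHuh2019, §4.5 proof of Prop. 4.22; §2.2 Thm. 2.10] -/
theorem linearSubst_homPartitionPoly_eq_bivariate (μ : Set σ → ℝ) :
    linearSubst (fun (o : Option σ) (k : Fin 2) ↦ if k = o.elim (1 : Fin 2) (fun _ ↦ 0) then (1 : ℝ) else 0)
        (homPartitionPoly μ) =
      bivariate (Fintype.card σ) (rankSequence μ) := by
  classical
  have hg : (fun o : Option σ ↦ ∑ k : Fin 2,
      (if k = o.elim (1 : Fin 2) (fun _ ↦ 0) then (1 : ℝ) else 0) • (X k : MvPolynomial (Fin 2) ℝ)) =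
      fun o ↦ X (o.elim (1 : Fin 2) (fun _ ↦ 0)) := by
    funext o
    simp_rw [ite_smul, one_smul, zero_smul]
    rw [Finset.sum_ite_eq', if_pos (Finset.mem_univ _)]
  -- each monomial `μ(S) w_0^{n-|S|} w^S` goes to `μ(S) v_0^{|S|} v_1^{n-|S|}`
  have hmono : ∀ S : Set σ, bind₁ (fun o : Option σ ↦ (X (o.elim (1 : Fin 2) (fun _ ↦ 0)) : MvPolynomial (Fin 2) ℝ))
      (monomial (homIndSet S) (μ S)) = monomial (bideg S.ncard (Fintype.card σ - S.ncard)) (μ S) := fun S ↦ by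
    have h1 : ∏ o ∈ (homIndSet S).support, (X (o.elim (1 : Fin 2) (fun _ ↦ 0)) : MvPolynomial (Fin 2) ℝ) ^ homIndSet S o =
        ∏ o, (X (o.elim (1 : Fin 2) (fun _ ↦ 0)) : MvPolynomial (Fin 2) ℝ) ^ homIndSet S o :=
      Finset.prod_subset (Finset.subset_univ _) fun o _ ho ↦ by rw [Finsupp.notMem_support_iff.1 ho, pow_zero]
    rw [bind₁_monomial, h1, Fintype.prod_option, Option.elim_none, homIndSet_none]
    simp_rw [Option.elim_some, homIndSet_some]
    rw [Finset.prod_pow_eq_pow_sum, ← Finsupp.degree_eq_sum, degree_indSet, monomial_bideg, mul_comm (X 1 ^ _)]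
  rw [linearSubst, hg, homPartitionPoly, map_sum, bivariate_def]
  simp_rw [hmono]
  -- regroup the subsets by cardinality
  rw [← Finset.sum_fiberwise_of_maps_to (s := (Finset.univ : Finset (Set σ))) (t := Finset.range (Fintype.card σ + 1))
    (g := fun S : Set σ ↦ S.ncard) fun S _ ↦ Finset.mem_range.2 (Nat.lt_succ_of_le (ncard_le_card S))]
  refine Finset.sum_congr rfl fun k _ ↦ ?_
  rw [rankSequence, map_sum]
  refine Finset.sum_congr rfl fun S hS ↦ ?_
  rw [(Finset.mem_filter.1 hS).2]

end Substitutions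

/-! ## §3 Proposition 4.22 -/

section Prop422

/-- **"Any probability measure obtained from a Lorentzian probability measure by applying an external field is
Lorentzian"** (`x ≥ 0`; Theorem 2.10 with a diagonal matrix). [cite: BrandenHuh2019, §4.5 proof of Prop. 4.22;
§2.2 Thm. 2.10] -/
theorem isLorentzianMeasure_externalField {μ : Set σ → ℝ} (h : IsLorentzianMeasure μ) {x : σ → ℝ}
    (hx : ∀ i, 0 ≤ x i) : IsLorentzianMeasure (externalField x μ) := by
  classical
  rw [IsLorentzianMeasure, ← linearSubst_diag_homPartitionPoly]
  refine linearSubst_mem_lorentzian (fun o o' ↦ ?_) h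
  split_ifs
  · cases o with
    | none => exact zero_le_one
    | some i => exact hx i
  · exact le_rfl

/-- **The diagonalization of a Lorentzian measure is a Lorentzian bivariate form**: "By Theorem 2.10, the bivariate
homogeneous polynomial `w_0^n Z_μ(w_1/w_0, …, w_1/w_0)` is Lorentzian." [cite: BrandenHuh2019, §4.5 proof of
Prop. 4.22; §2.2 Thm. 2.10] -/
theorem IsLorentzianMeasure.bivariate_rankSequence_mem_lorentzian {μ : Set σ → ℝ} (h : IsLorentzianMeasure μ) :
    bivariate (Fintype.card σ) (rankSequence μ) ∈ lorentzian (Fin 2) (Fintype.card σ) := by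
  rw [← linearSubst_homPartitionPoly_eq_bivariate]
  exact linearSubst_mem_lorentzian (fun o k ↦ by split_ifs <;> [exact zero_le_one; exact le_rfl]) h

/-- **Brändén–Huh, Proposition 4.22 (the ULC half): a Lorentzian measure is ultra log-concave** —
`μ(C(n,k))²/C(n,k)² ≥ (μ(C(n,k-1))/C(n,k-1)) (μ(C(n,k+1))/C(n,k+1))` for `0 < k < n` ("by Example 2.26, its sequence of
coefficients must be ultra log-concave"). [cite: BrandenHuh2019, §4.5 Prop. 4.22 (p. 59); §2.4 Example 2.26] -/
theorem IsLorentzianMeasure.isULC {μ : Set σ → ℝ} (h : IsLorentzianMeasure μ) : IsULC μ :=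
  ((bivariate_mem_lorentzian_iff fun k _ ↦ rankSequence_nonneg h.nonneg k).1
    h.bivariate_rankSequence_mem_lorentzian).1

/-- The rank sequence of a Lorentzian measure has no internal zeros (the other half of Example 2.26's criterion).
[cite: BrandenHuh2019, §4.5 proof of Prop. 4.22; §2.4 Example 2.26] -/
theorem IsLorentzianMeasure.hasNoInternalZeros_rankSequence {μ : Set σ → ℝ} (h : IsLorentzianMeasure μ) :
    HasNoInternalZeros (Fintype.card σ) (rankSequence μ) :=
  ((bivariate_mem_lorentzian_iff fun k _ ↦ rankSequence_nonneg h.nonneg k).1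
    h.bivariate_rankSequence_mem_lorentzian).2

/-- **Brändén–Huh, Proposition 4.22: "If `μ` is Lorentzian, then `μ` is U̲L̲C̲"** — ULC after every external field
`x` (`x ≥ 0` here, containing the source's `x ∈ ℝ^n_{>0}`). [cite: BrandenHuh2019, §4.5 Prop. 4.22 (p. 59)] -/
theorem IsLorentzianMeasure.isULC_externalField {μ : Set σ → ℝ} (h : IsLorentzianMeasure μ) {x : σ → ℝ}
    (hx : ∀ i, 0 ≤ x i) : IsULC (externalField x μ) :=
  (isLorentzianMeasure_externalField h hx).isULC

end Prop422

end Literature.Combinatorics.LorentzianPolynomials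

end
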